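import Mathlib
import Summits.Ventures.PercRepro2.Tail2D
import Summits.Ventures.PercRepro2.Tail2DBundle

/-!
# (TAIL-M♮) for bundle-parallel series–parallel networks (seat mine-b, cell pub-perc-repro2)

The two-dimensional tail calculus: a free edge has tail `bconv w11 1 pt` (`T(a, b) = pt(a-1, b) + pt(a, b-1)`,
i.e. `2, 1, 1, 0` at `(0,0), (1,0), (0,1), (1,1)`), series composition multiplies tails (both flows are
minima), and parallel composition with a free edge is the `(1, 1)`-convolution along the anti-diagonal
direction.  `BSP` is the grammar generated by these three constructors — every series–parallel term in
which each parallel node has a bundle of free edges as one of its two factors.  `BSP.tail_isMTail`: every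
such tail is M♮-concave (Tail2D.lean, Tail2DBundle.lean); the corollaries are the log-concavity of the tail
along anti-diagonals (TAIL-LC, conjectures/MINE-B.md §30.10–30.12), rows and columns.
-/

open Finset

namespace Summit.Ventures.PercRepro2.Tail2D

section Corollaries

variable {T : ℤ → ℤ → ℝ} {L : ℤ} (hT : IsMTail T L)

include hT

/-- log-concavity of an M♮-concave tail along anti-diagonals:
`T (a+1) (b-1) * T (a-1) (b+1) ≤ T a b ^ 2` (from `m2` and `m4`). -/
theorem IsMTail.antidiag (a b : ℤ) : T (a + 1) (b - 1) * T (a - 1) (b + 1) ≤ T a b * T a b := by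
  have h2 : T (a + 1) (b - 1) * T (a - 1) b ≤ T a b * T a (b - 1) := by
    convert hT.m2 (a - 1) b using 3 <;> ring
  have h4 : T (a - 1) (b + 1) * T a (b - 1) ≤ T a b * T (a - 1) b := by
    convert hT.m4 a (b - 1) using 3 <;> ring
  by_cases hz : T (a - 1) b * T a (b - 1) = 0
  · rcases mul_eq_zero.mp hz with h | h
    · have : T (a - 1) (b + 1) = 0 := le_antisymm (h ▸ hT.anti₂ (a - 1) b) (hT.nonneg _ _)
      rw [this, mul_zero]; exact mul_nonneg (hT.nonneg _ _) (hT.nonneg _ _)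
    · have : T (a + 1) (b - 1) = 0 := le_antisymm (h ▸ hT.anti₁ a (b - 1)) (hT.nonneg _ _)
      rw [this, zero_mul]; exact mul_nonneg (hT.nonneg _ _) (hT.nonneg _ _)
  have hpos : 0 < T (a - 1) b * T a (b - 1) :=
    lt_of_le_of_ne (mul_nonneg (hT.nonneg _ _) (hT.nonneg _ _)) (Ne.symm hz)
  have key : T (a + 1) (b - 1) * T (a - 1) (b + 1) * (T (a - 1) b * T a (b - 1))
      ≤ T a b * T a b * (T (a - 1) b * T a (b - 1)) := by
    calc T (a + 1) (b - 1) * T (a - 1) (b + 1) * (T (a - 1) b * T a (b - 1))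
        = (T (a + 1) (b - 1) * T (a - 1) b) * (T (a - 1) (b + 1) * T a (b - 1)) := by ring
      _ ≤ (T a b * T a (b - 1)) * (T a b * T (a - 1) b) :=
          mul_le_mul h2 h4 (mul_nonneg (hT.nonneg _ _) (hT.nonneg _ _)) (mul_nonneg (hT.nonneg _ _) (hT.nonneg _ _))
      _ = T a b * T a b * (T (a - 1) b * T a (b - 1)) := by ring
  exact le_of_mul_le_mul_right key hpos

/-- log-concavity along rows: `T (a+2) b * T a b ≤ T (a+1) b ^ 2` (from `m1` and `m2`). -/
theorem IsMTail.row (a b : ℤ) : T (a + 2) b * T a b ≤ T (a + 1) b * T (a + 1) b := by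
  have h1 : T (a + 2) b * T (a + 1) (b - 1) ≤ T (a + 2) (b - 1) * T (a + 1) b := by
    convert hT.m1 (a + 1) (b - 1) using 3 <;> ring
  have h2 := hT.m2 a b
  by_cases hz : T (a + 1) (b - 1) * T (a + 2) (b - 1) = 0
  · rcases mul_eq_zero.mp hz with h | h
    · have : T (a + 2) b = 0 := by
        have s1 := hT.anti₁_of_le (show a + 1 ≤ a + 2 by omega) (b - 1)
        have s2 := hT.anti₂ (a + 2) (b - 1)
        rw [show b - 1 + 1 = b by ring] at s2
        exact le_antisymm (le_trans s2 (h ▸ s1)) (hT.nonneg _ _)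
      rw [this, zero_mul]; exact mul_nonneg (hT.nonneg _ _) (hT.nonneg _ _)
    · have : T (a + 2) b = 0 := by
        have s2 := hT.anti₂ (a + 2) (b - 1)
        rw [show b - 1 + 1 = b by ring, h] at s2
        exact le_antisymm s2 (hT.nonneg _ _)
      rw [this, zero_mul]; exact mul_nonneg (hT.nonneg _ _) (hT.nonneg _ _)
  have hpos : 0 < T (a + 1) (b - 1) * T (a + 2) (b - 1) :=
    lt_of_le_of_ne (mul_nonneg (hT.nonneg _ _) (hT.nonneg _ _)) (Ne.symm hz)
  have key : T (a + 2) b * T a b * (T (a + 1) (b - 1) * T (a + 2) (b - 1))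
      ≤ T (a + 1) b * T (a + 1) b * (T (a + 1) (b - 1) * T (a + 2) (b - 1)) := by
    calc T (a + 2) b * T a b * (T (a + 1) (b - 1) * T (a + 2) (b - 1))
        = (T (a + 2) b * T (a + 1) (b - 1)) * (T (a + 2) (b - 1) * T a b) := by ring
      _ ≤ (T (a + 2) (b - 1) * T (a + 1) b) * (T (a + 1) b * T (a + 1) (b - 1)) :=
          mul_le_mul h1 h2 (mul_nonneg (hT.nonneg _ _) (hT.nonneg _ _)) (mul_nonneg (hT.nonneg _ _) (hT.nonneg _ _))
      _ = T (a + 1) b * T (a + 1) b * (T (a + 1) (b - 1) * T (a + 2) (b - 1)) := by ring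
  exact le_of_mul_le_mul_right key hpos

/-- log-concavity along columns: `T a (b+2) * T a b ≤ T a (b+1) ^ 2` (from `m1` and `m4`). -/
theorem IsMTail.col (a b : ℤ) : T a (b + 2) * T a b ≤ T a (b + 1) * T a (b + 1) := by
  have h1 : T a (b + 2) * T (a - 1) (b + 1) ≤ T a (b + 1) * T (a - 1) (b + 2) := by
    convert hT.m1 (a - 1) (b + 1) using 3 <;> ring
  have h4 := hT.m4 a b
  by_cases hz : T (a - 1) (b + 1) * T (a - 1) (b + 2) = 0
  · rcases mul_eq_zero.mp hz with h | h
    · have : T a (b + 2) = 0 := by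
        have s1 := hT.anti₂_of_le (a - 1) (show b + 1 ≤ b + 2 by omega)
        have s2 := hT.anti₁ (a - 1) (b + 2)
        rw [show a - 1 + 1 = a by ring] at s2
        exact le_antisymm (le_trans s2 (h ▸ s1)) (hT.nonneg _ _)
      rw [this, zero_mul]; exact mul_nonneg (hT.nonneg _ _) (hT.nonneg _ _)
    · have : T a (b + 2) = 0 := by
        have s2 := hT.anti₁ (a - 1) (b + 2)
        rw [show a - 1 + 1 = a by ring, h] at s2
        exact le_antisymm s2 (hT.nonneg _ _)
      rw [this, zero_mul]; exact mul_nonneg (hT.nonneg _ _) (hT.nonneg _ _)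
  have hpos : 0 < T (a - 1) (b + 1) * T (a - 1) (b + 2) :=
    lt_of_le_of_ne (mul_nonneg (hT.nonneg _ _) (hT.nonneg _ _)) (Ne.symm hz)
  have key : T a (b + 2) * T a b * (T (a - 1) (b + 1) * T (a - 1) (b + 2))
      ≤ T a (b + 1) * T a (b + 1) * (T (a - 1) (b + 1) * T (a - 1) (b + 2)) := by
    calc T a (b + 2) * T a b * (T (a - 1) (b + 1) * T (a - 1) (b + 2))
        = (T a (b + 2) * T (a - 1) (b + 1)) * (T (a - 1) (b + 2) * T a b) := by ring
      _ ≤ (T a (b + 1) * T (a - 1) (b + 2)) * (T a (b + 1) * T (a - 1) (b + 1)) :=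
          mul_le_mul h1 h4 (mul_nonneg (hT.nonneg _ _) (hT.nonneg _ _)) (mul_nonneg (hT.nonneg _ _) (hT.nonneg _ _))
      _ = T a (b + 1) * T a (b + 1) * (T (a - 1) (b + 1) * T (a - 1) (b + 2)) := by ring
  exact le_of_mul_le_mul_right key hpos

/-- log-concavity along an anti-diagonal, iterated (balanced pairs on one `w`-line):
`u_{k'} u_{k-1} ≤ u_k u_{k'-1}` for `k ≤ k'`, `u_j = T (a + j) (b - j)`. -/
theorem IsMTail.antidiag_iter (a b : ℤ) {k k' : ℤ} (h : k ≤ k') :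
    T (a + k') (b - k') * T (a + (k - 1)) (b - (k - 1)) ≤ T (a + k) (b - k) * T (a + (k' - 1)) (b - (k' - 1)) := by
  obtain ⟨d, rfl⟩ : ∃ d : ℕ, k' = k + d := ⟨(k' - k).toNat, by omega⟩
  induction d with
  | zero => simp
  | succ d ih =>
    have ih := ih (by omega)
    set k' := k + (d : ℤ) with hk'
    have e1 : k + ((d + 1 : ℕ) : ℤ) = k' + 1 := by rw [hk']; push_cast; ring
    rw [e1]
    have lc : T (a + (k' + 1)) (b - (k' + 1)) * T (a + (k' - 1)) (b - (k' - 1)) ≤ T (a + k') (b - k') * T (a + k') (b - k') := by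
      convert hT.antidiag (a + k') (b - k') using 3 <;> ring
    rw [show k' + 1 - 1 = k' by ring]
    by_cases hz : T (a + k') (b - k') = 0
    · by_cases hz1 : T (a + (k' + 1)) (b - (k' + 1)) = 0
      · rw [hz1, zero_mul]; exact mul_nonneg (hT.nonneg _ _) (hT.nonneg _ _)
      · have hpos : 0 < T (a + (k' + 1)) (b - (k' + 1)) := lt_of_le_of_ne (hT.nonneg _ _) (Ne.symm hz1)
        have := hT.zero_left (k := k - 1) (by omega) hz hpos
        rw [this, mul_zero]; exact mul_nonneg (hT.nonneg _ _) (hT.nonneg _ _)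
    · have hpos : 0 < T (a + k') (b - k') := lt_of_le_of_ne (hT.nonneg _ _) (Ne.symm hz)
      have key : T (a + (k' + 1)) (b - (k' + 1)) * T (a + (k - 1)) (b - (k - 1)) * T (a + k') (b - k')
          ≤ T (a + k) (b - k) * T (a + k') (b - k') * T (a + k') (b - k') := by
        calc T (a + (k' + 1)) (b - (k' + 1)) * T (a + (k - 1)) (b - (k - 1)) * T (a + k') (b - k')
            = T (a + (k' + 1)) (b - (k' + 1)) * (T (a + k') (b - k') * T (a + (k - 1)) (b - (k - 1))) := by ring
          _ ≤ T (a + (k' + 1)) (b - (k' + 1)) * (T (a + k) (b - k) * T (a + (k' - 1)) (b - (k' - 1))) :=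
              mul_le_mul_of_nonneg_left ih (hT.nonneg _ _)
          _ = T (a + k) (b - k) * (T (a + (k' + 1)) (b - (k' + 1)) * T (a + (k' - 1)) (b - (k' - 1))) := by ring
          _ ≤ T (a + k) (b - k) * (T (a + k') (b - k') * T (a + k') (b - k')) :=
              mul_le_mul_of_nonneg_left lc (hT.nonneg _ _)
          _ = _ := by ring
      exact le_of_mul_le_mul_right key hpos

/-- **BAL** for a symmetric M♮-concave tail: `T (a-1) (b+1) ≤ T a b` for `a ≤ b` (the anti-diagonal
sequence is symmetric and log-concave, hence non-decreasing up to the middle). -/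
theorem IsMTail.bal (hsymm : ∀ x y, T x y = T y x) {a b : ℤ} (hab : a ≤ b) :
    T (a - 1) (b + 1) ≤ T a b := by
  have key := hT.antidiag_iter 0 (a + b) (k := a) (k' := b + 1) (by omega)
  -- key : T (0 + (b+1)) (a+b-(b+1)) * T (0 + (a-1)) (a+b-(a-1)) ≤ T (0+a) (a+b-a) * T (0+(b+1-1)) (a+b-(b+1-1))
  have e1 : T (0 + (b + 1)) (a + b - (b + 1)) = T (a - 1) (b + 1) := by
    rw [hsymm]; congr 1 <;> ring
  have e2 : T (0 + (a - 1)) (a + b - (a - 1)) = T (a - 1) (b + 1) := by congr 1 <;> ring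
  have e3 : T (0 + a) (a + b - a) = T a b := by congr 1 <;> ring
  have e4 : T (0 + (b + 1 - 1)) (a + b - (b + 1 - 1)) = T a b := by rw [hsymm]; congr 1 <;> ring
  rw [e1, e2, e3, e4] at key
  exact (mul_self_le_mul_self_iff (hT.nonneg _ _) (hT.nonneg _ _)).mpr key

end Corollaries

section Grammar

/-- the weights of a single free edge: `(1, 1)` on `[0, 1]` -/
noncomputable def w11 (i : ℤ) : ℝ := if 0 ≤ i ∧ i ≤ 1 then 1 else 0

/-- the single-edge weights are log-concave -/
theorem w11_isLCW : IsLCW w11 1 where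
  pos := by
    intro i h0 h1; unfold w11
    have h : 0 ≤ i ∧ i ≤ 1 := ⟨h0, h1⟩
    simp [h]
  zero := by
    intro i h; unfold w11
    have h' : ¬ (0 ≤ i ∧ i ≤ 1) := by omega
    simp [h']
  lc := by intro i h1 h2; omega

/-- the `(1, 1)`-convolution written out: `T a (b-1) + T (a-1) b` -/
theorem bconv_w11 (T : ℤ → ℤ → ℝ) (a b : ℤ) : bconv w11 1 T a b = T a (b - 1) + T (a - 1) b := by
  unfold bconv
  have h01 : Finset.Icc (0 : ℤ) 1 = {0, 1} := by
    ext i; simp only [Finset.mem_Icc, Finset.mem_insert, Finset.mem_singleton]; omega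
  rw [h01, Finset.sum_pair (by norm_num : (0 : ℤ) ≠ 1)]
  have w0 : w11 0 = 1 := by unfold w11; simp
  have w1 : w11 1 = 1 := by unfold w11; simp
  rw [w0, w1]; simp

/-- bundle-parallel series–parallel terms: a free edge, series composition, and parallel composition with
one free edge (iterated: parallel composition with a bundle of any width) -/
inductive BSP : Type
  | edge : BSP
  | ser : BSP → BSP → BSP
  | pe : BSP → BSP

/-- the top level (the max-flow) of a term -/
def BSP.level : BSP → ℤ
  | .edge => 1
  | .ser a b => min a.level b.level
  | .pe a => a.level + 1

/-- the two-dimensional tail calculus: edge ↦ `bconv w11 1 pt`, series ↦ product, parallel with an edge ↦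
`bconv w11 1` -/
noncomputable def BSP.tail : BSP → (ℤ → ℤ → ℝ)
  | .edge => bconv w11 1 pt
  | .ser a b => fun x y => a.tail x y * b.tail x y
  | .pe a => bconv w11 1 a.tail

/-- **(TAIL-M♮) on bundle-parallel series–parallel networks**: every tail of the calculus is an
M♮-concave tail with top level `BSP.level`. -/
theorem BSP.tail_isMTail : ∀ t : BSP, IsMTail t.tail t.level
  | .edge => by
      have h := bconv_isMTail pt_isMTail w11_isLCW zero_le_one
      rw [zero_add] at h; exact h
  | .ser a b => IsMTail.mul (BSP.tail_isMTail a) (BSP.tail_isMTail b)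
  | .pe a => bconv_isMTail (BSP.tail_isMTail a) w11_isLCW zero_le_one

/-- **(TAIL-LC)**: the tail is log-concave along anti-diagonals -/
theorem BSP.tail_antidiag (t : BSP) (a b : ℤ) :
    t.tail (a + 1) (b - 1) * t.tail (a - 1) (b + 1) ≤ t.tail a b * t.tail a b :=
  (BSP.tail_isMTail t).antidiag a b

/-- the tail is log-concave along rows -/
theorem BSP.tail_row (t : BSP) (a b : ℤ) : t.tail (a + 2) b * t.tail a b ≤ t.tail (a + 1) b * t.tail (a + 1) b :=
  (BSP.tail_isMTail t).row a b

/-- the tail is log-concave along columns -/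
theorem BSP.tail_col (t : BSP) (a b : ℤ) : t.tail a (b + 2) * t.tail a b ≤ t.tail a (b + 1) * t.tail a (b + 1) :=
  (BSP.tail_isMTail t).col a b

/-- the tail is log-submodular -/
theorem BSP.tail_submod (t : BSP) (a b : ℤ) :
    t.tail (a + 1) (b + 1) * t.tail a b ≤ t.tail (a + 1) b * t.tail a (b + 1) :=
  (BSP.tail_isMTail t).m1 a b

/-- the tails of the calculus are symmetric under the colour swap -/
theorem BSP.tail_symm : ∀ (t : BSP) (a b : ℤ), t.tail a b = t.tail b a
  | .edge, a, b => by
      show bconv w11 1 pt a b = bconv w11 1 pt b a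
      have ps : ∀ x y, pt x y = pt y x := by intro x y; unfold pt; simp only [and_comm]
      rw [bconv_w11, bconv_w11, ps a (b - 1), ps (a - 1) b]; ring
  | .ser s t, a, b => by
      show s.tail a b * t.tail a b = s.tail b a * t.tail b a
      rw [BSP.tail_symm s a b, BSP.tail_symm t a b]
  | .pe s, a, b => by
      show bconv w11 1 s.tail a b = bconv w11 1 s.tail b a
      rw [bconv_w11, bconv_w11, BSP.tail_symm s a (b - 1), BSP.tail_symm s (a - 1) b]; ring

/-- a bundle of `n + 1` free edges in parallel -/
def BSP.bundle : ℕ → BSP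
  | 0 => .edge
  | n + 1 => .pe (BSP.bundle n)

/-- `t` in parallel with a bundle of `n` free edges -/
def BSP.parBundle (t : BSP) : ℕ → BSP
  | 0 => t
  | n + 1 => .pe (t.parBundle n)

/-- the level of a bundle of `n + 1` edges is `n + 1` -/
theorem BSP.level_bundle (n : ℕ) : (BSP.bundle n).level = n + 1 := by
  induction n with
  | zero => rfl
  | succ n ih => simp only [BSP.bundle, BSP.level, ih]; push_cast; ring

/-- the level of `t` in parallel with `n` edges is `t.level + n` -/
theorem BSP.level_parBundle (t : BSP) (n : ℕ) : (t.parBundle n).level = t.level + n := by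
  induction n with
  | zero => simp [BSP.parBundle]
  | succ n ih => simp only [BSP.parBundle, BSP.level, ih]; push_cast; ring

/-- example: the series of two bundles `P(e³) ∧ P(e²⁰)` (the wide-neck network of conjectures/MINE-B.md
§30.11, whose level-2 slice (193, 120, 193) is bimodal) has an M♮-concave two-copy tail of level 3 -/
example : IsMTail (BSP.ser (BSP.bundle 2) (BSP.bundle 19)).tail 3 :=
  BSP.tail_isMTail _

/-- **BAL on the calculus**: `T (a-1) (b+1) ≤ T a b` for `a ≤ b` -/
theorem BSP.tail_bal (t : BSP) {a b : ℤ} (hab : a ≤ b) : t.tail (a - 1) (b + 1) ≤ t.tail a b :=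
  (BSP.tail_isMTail t).bal (BSP.tail_symm t) hab

end Grammar

end Summit.Ventures.PercRepro2.Tail2D
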